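import Summits.CriticalPhenomena.PercolationContinuityZ3.Theorems.SahiMasterFamilySDHFlatThree

/-!
# SDH♭(4) holds: the first non-trivial rung of the slot-decoupled ladder (one union-closed family against one hull point, on four points)

Unit `prim-masterthm-p4` (gen 18; crux anchor stmt-CriticalPhenomena-4575, helper work; memo
`run/shared/lean/prim/prim-masterthm/prim-masterthm-p4/DELETION-PICTURE.md` §2–§3, Prop. 3.2 with n = 3).  Companion of `…SDHFlat` / `…SDHFlatThree`.

* `sum_finset_fin_four` — summing over the sixteen subsets of `Fin 4`;
* `lam_four_eq` — **closed form of `Λ(𝒢, β)` on four points** for every family `𝒢 ∋ univ` and every set function `β`, written as the memo's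
  `Λ = Σ_{S∉𝒢} c(S)`:  `Σ_z (1−[univ∖z∈𝒢])·6β_z + Σ_{ab} (1−[ab∈𝒢])·2(β_{cd} − β_cβ_d) + Σ_t (1−[t∈𝒢])·(6 − 2Σ_{z≠t}β_z − Σ_{pq⊆univ∖t}(β_{pq} − β_pβ_q))`
  (`cd = univ∖ab`); only the pair terms can be negative;
* `pair_charge`, `absX_le`, `link_nonneg` — the three elementary real inequalities of the LOC′(3) mechanism: a bad pair `ab ∉ 𝒢` has a bad point
  (`[a∈𝒢] + [b∈𝒢] ≤ 1 + [ab∈𝒢]`, union-closure), so its possibly negative term is charged to the bad points of `ab`; around a bad point `t` the link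
  bracket is `6 − 2Σβ_z − Σ|β_{pq} − β_pβ_q| ≥ Σ_{pq}(1−β_p)(1−β_q) ≥ 0`, using `β_p + β_q ≤ 1 + β_{pq}` (pairwise union) and the box once each;
* `lam_four_nonneg_of_pairUnion` — hence **`Λ(𝒢, β) ≥ 0` for every union-closed `𝒢 ∋ univ` and every `β` in the LINEAR relaxation** box + pairwise union;
* `mixture_add_le_one_add_union` — mixtures of union-closed indicator functions satisfy the pairwise-union inequalities;
* **`sdhFlatNonneg_four : SDHFlatNonneg 4`** (and, via the landed ladder, a third kernel route to `HFlatNonneg 4` / `UCHullNonneg 4`, not restated).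

HONEST FRAMING: SDH♭(k) for k ≥ 5 (whose localisation LOC′(4) needs the hull beyond pairwise union), H♭ (k ≥ 5), H♯ (k ≥ 4), (UC-hull)_k (k ≥ 8),
Sahi's `C_k` and the master theorem remain OPEN.  Axioms standard. [this work]
-/

noncomputable section

open scoped Classical

namespace Summit.CriticalPhenomena.PercolationContinuityZ3.Theorems

namespace SDHFlat

open Finset Function
open Literature.Combinatorics.Sahi2008
open PrincipalCapBeta (phiSet)
open HFlat (mixture_nonneg)
open HSharp (mixture_le_one)

/-! ### Three elementary real inequalities -/

/-- Charging a pair term to the end points: if `g_{ab} ≤ 1` and `g_a + g_b ≤ 1 + g_{ab}` then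
`((1−g_a)+(1−g_b))·2·min(0,X) ≤ (1−g_{ab})·2X`. [this work] -/
theorem pair_charge {ga gb gab X : ℝ} (hab1 : gab ≤ 1) (huc : ga + gb ≤ 1 + gab) :
    ((1 - ga) + (1 - gb)) * (2 * min 0 X) ≤ (1 - gab) * (2 * X) := by
  rcases le_or_gt 0 X with hX | hX
  · rw [min_eq_left hX]
    nlinarith [mul_nonneg (sub_nonneg.2 hab1) hX]
  · rw [min_eq_right hX.le]
    nlinarith [mul_le_mul_of_nonpos_right (show (1 - gab) ≤ (1 - ga) + (1 - gb) by linarith) (by linarith : 2 * X ≤ 0)]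

/-- `−|β_{pq} − β_pβ_q| ≥ β_pβ_q − 1` on the box under `β_p + β_q ≤ 1 + β_{pq}`. [this work] -/
theorem absX_le {p q bpq : ℝ} (hp0 : 0 ≤ p) (hp1 : p ≤ 1) (hq0 : 0 ≤ q) (hq1 : q ≤ 1) (hb1 : bpq ≤ 1)
    (hu : p + q ≤ 1 + bpq) : p * q - 1 ≤ -(bpq - p * q) + 2 * min 0 (bpq - p * q) := by
  rcases le_or_gt 0 (bpq - p * q) with h | h
  · rw [min_eq_left h]
    nlinarith [mul_nonneg hp0 hq0]
  · rw [min_eq_right h.le]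
    nlinarith [mul_nonneg hp0 (sub_nonneg.2 hq1), mul_nonneg hq0 (sub_nonneg.2 hp1)]

/-- The link bracket around a bad point is nonnegative: `6 − 2(u+v+w) − ΣX + 2Σ min(0,X) ≥ Σ (1−p)(1−q) ≥ 0` (for `u, v, w ≤ 1`). [this work] -/
theorem link_nonneg {u v w Xuv Xuw Xvw : ℝ} (hu1 : u ≤ 1) (hv1 : v ≤ 1) (hw1 : w ≤ 1)
    (huv : u * v - 1 ≤ -Xuv + 2 * min 0 Xuv) (huw : u * w - 1 ≤ -Xuw + 2 * min 0 Xuw) (hvw : v * w - 1 ≤ -Xvw + 2 * min 0 Xvw) :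
    0 ≤ 6 - 2 * (u + v + w) - (Xuv + Xuw + Xvw) + 2 * (min 0 Xuv + min 0 Xuw + min 0 Xvw) := by
  nlinarith [mul_nonneg (sub_nonneg.2 hu1) (sub_nonneg.2 hv1), mul_nonneg (sub_nonneg.2 hu1) (sub_nonneg.2 hw1),
    mul_nonneg (sub_nonneg.2 hv1) (sub_nonneg.2 hw1)]

/-! ### Four points: the closed form -/

/-- Summing over the sixteen subsets of `Fin 4`. [folklore] -/
theorem sum_finset_fin_four (F : Finset (Fin 4) → ℝ) :
    ∑ B : Finset (Fin 4), F B =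
      F ∅ + F {3} + (F {2} + F {2, 3}) + (F {1} + F {1, 3} + (F {1, 2} + F {1, 2, 3}))
        + (F {0} + F {0, 3} + (F {0, 2} + F {0, 2, 3}) + (F {0, 1} + F {0, 1, 3} + (F {0, 1, 2} + F univ))) := by
  have hU : (univ : Finset (Fin 4)) = insert 0 (insert 1 (insert 2 (insert 3 ∅))) := by decide
  rw [← powerset_univ, hU]
  simp only [sum_powerset_insert (show (0 : Fin 4) ∉ (insert 1 (insert 2 (insert 3 ∅)) : Finset (Fin 4)) by decide),
    sum_powerset_insert (show (1 : Fin 4) ∉ (insert 2 (insert 3 ∅) : Finset (Fin 4)) by decide),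
    sum_powerset_insert (show (2 : Fin 4) ∉ (insert 3 ∅ : Finset (Fin 4)) by decide),
    sum_powerset_insert (show (3 : Fin 4) ∉ (∅ : Finset (Fin 4)) by decide), powerset_empty, sum_singleton]
  simp only [insert_empty]

/-- **`Λ(𝒢, β)` on four points in closed form** (`= Σ_{S∉𝒢} c(S)` of the memo, Identity 2.2 at k = 4): for every family `𝒢 ∋ univ` and
every set function `β`. [this work] -/
theorem lam_four_eq (𝒢 : Finset (Finset (Fin 4))) (htop : univ ∈ 𝒢) (β : Finset (Fin 4) → ℝ) :
    lam 𝒢 β =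
      ((1 - (if ({1, 2, 3} : Finset (Fin 4)) ∈ 𝒢 then (1:ℝ) else 0)) * (6 * β {0})
        + (1 - (if ({0, 2, 3} : Finset (Fin 4)) ∈ 𝒢 then (1:ℝ) else 0)) * (6 * β {1})
        + (1 - (if ({0, 1, 3} : Finset (Fin 4)) ∈ 𝒢 then (1:ℝ) else 0)) * (6 * β {2})
        + (1 - (if ({0, 1, 2} : Finset (Fin 4)) ∈ 𝒢 then (1:ℝ) else 0)) * (6 * β {3}))
      + ((1 - (if ({0, 1} : Finset (Fin 4)) ∈ 𝒢 then (1:ℝ) else 0)) * (2 * (β {2, 3} - β {2} * β {3}))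
        + (1 - (if ({0, 2} : Finset (Fin 4)) ∈ 𝒢 then (1:ℝ) else 0)) * (2 * (β {1, 3} - β {1} * β {3}))
        + (1 - (if ({0, 3} : Finset (Fin 4)) ∈ 𝒢 then (1:ℝ) else 0)) * (2 * (β {1, 2} - β {1} * β {2}))
        + (1 - (if ({1, 2} : Finset (Fin 4)) ∈ 𝒢 then (1:ℝ) else 0)) * (2 * (β {0, 3} - β {0} * β {3}))
        + (1 - (if ({1, 3} : Finset (Fin 4)) ∈ 𝒢 then (1:ℝ) else 0)) * (2 * (β {0, 2} - β {0} * β {2}))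
        + (1 - (if ({2, 3} : Finset (Fin 4)) ∈ 𝒢 then (1:ℝ) else 0)) * (2 * (β {0, 1} - β {0} * β {1})))
      + ((1 - (if ({0} : Finset (Fin 4)) ∈ 𝒢 then (1:ℝ) else 0)) *
          (6 - 2 * (β {1} + β {2} + β {3}) - ((β {1, 2} - β {1} * β {2}) + (β {1, 3} - β {1} * β {3}) + (β {2, 3} - β {2} * β {3})))
        + (1 - (if ({1} : Finset (Fin 4)) ∈ 𝒢 then (1:ℝ) else 0)) *
          (6 - 2 * (β {0} + β {2} + β {3}) - ((β {0, 2} - β {0} * β {2}) + (β {0, 3} - β {0} * β {3}) + (β {2, 3} - β {2} * β {3})))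
        + (1 - (if ({2} : Finset (Fin 4)) ∈ 𝒢 then (1:ℝ) else 0)) *
          (6 - 2 * (β {0} + β {1} + β {3}) - ((β {0, 1} - β {0} * β {1}) + (β {0, 3} - β {0} * β {3}) + (β {1, 3} - β {1} * β {3})))
        + (1 - (if ({3} : Finset (Fin 4)) ∈ 𝒢 then (1:ℝ) else 0)) *
          (6 - 2 * (β {0} + β {1} + β {2}) - ((β {0, 1} - β {0} * β {1}) + (β {0, 2} - β {0} * β {2}) + (β {1, 2} - β {1} * β {2})))) := by
  have κu : blockCoef β (univ : Finset (Fin 4)) = 1 := blockCoef_univ β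
  have κ012 : blockCoef β ({0, 1, 2} : Finset (Fin 4)) = -β {3} :=
    blockCoef_of_compl_eq_singleton (k := 3) β (by decide)
  have κ013 : blockCoef β ({0, 1, 3} : Finset (Fin 4)) = -β {2} :=
    blockCoef_of_compl_eq_singleton (k := 3) β (by decide)
  have κ023 : blockCoef β ({0, 2, 3} : Finset (Fin 4)) = -β {1} :=
    blockCoef_of_compl_eq_singleton (k := 3) β (by decide)
  have κ123 : blockCoef β ({1, 2, 3} : Finset (Fin 4)) = -β {0} :=
    blockCoef_of_compl_eq_singleton (k := 3) β (by decide)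
  have κ01 : blockCoef β ({0, 1} : Finset (Fin 4)) = β {2} * β {3} - β {2, 3} :=
    blockCoef_of_compl_eq_pair (k := 3) β (by decide) (by decide)
  have κ02 : blockCoef β ({0, 2} : Finset (Fin 4)) = β {1} * β {3} - β {1, 3} :=
    blockCoef_of_compl_eq_pair (k := 3) β (by decide) (by decide)
  have κ03 : blockCoef β ({0, 3} : Finset (Fin 4)) = β {1} * β {2} - β {1, 2} :=
    blockCoef_of_compl_eq_pair (k := 3) β (by decide) (by decide)
  have κ12 : blockCoef β ({1, 2} : Finset (Fin 4)) = β {0} * β {3} - β {0, 3} :=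
    blockCoef_of_compl_eq_pair (k := 3) β (by decide) (by decide)
  have κ13 : blockCoef β ({1, 3} : Finset (Fin 4)) = β {0} * β {2} - β {0, 2} :=
    blockCoef_of_compl_eq_pair (k := 3) β (by decide) (by decide)
  have κ23 : blockCoef β ({2, 3} : Finset (Fin 4)) = β {0} * β {1} - β {0, 1} :=
    blockCoef_of_compl_eq_pair (k := 3) β (by decide) (by decide)
  have c01 : ({0, 1} : Finset (Fin 4)).card = 2 := by decide
  have c02 : ({0, 2} : Finset (Fin 4)).card = 2 := by decide
  have c03 : ({0, 3} : Finset (Fin 4)).card = 2 := by decide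
  have c12 : ({1, 2} : Finset (Fin 4)).card = 2 := by decide
  have c13 : ({1, 3} : Finset (Fin 4)).card = 2 := by decide
  have c23 : ({2, 3} : Finset (Fin 4)).card = 2 := by decide
  have c012 : ({0, 1, 2} : Finset (Fin 4)).card = 3 := by decide
  have c013 : ({0, 1, 3} : Finset (Fin 4)).card = 3 := by decide
  have c023 : ({0, 2, 3} : Finset (Fin 4)).card = 3 := by decide
  have c123 : ({1, 2, 3} : Finset (Fin 4)).card = 3 := by decide
  have cu : (univ : Finset (Fin 4)).card = 4 := by rw [card_univ, Fintype.card_fin]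
  have f2 : Nat.factorial 2 = 2 := rfl
  have f3 : Nat.factorial 3 = 6 := rfl
  -- the hybrid functional as an indicator sum over all sixteen subsets
  have hhyb : hyb 𝒢 β = ∑ B : Finset (Fin 4), (if B ∈ 𝒢 then (1:ℝ) else 0) * (((B.card : ℝ) * ((B.card - 1).factorial : ℝ)) * blockCoef β B) := by
    unfold hyb
    simp_rw [boole_mul]
    rw [← sum_filter]
    congr 1
    ext B; simp only [mem_filter, mem_univ, true_and]
  have hcap : ∀ t : Fin 4, phiSet 4 (fun S => if t ∈ S then 1 else β S) =
      ∑ B : Finset (Fin 4), (if t ∈ B then ((B.card - 1).factorial : ℝ) * blockCoef β B else 0) :=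
    fun t => phiSet_cap_eq_sum_blockCoef (k := 3) β t
  unfold lam
  rw [hhyb, Fin.sum_univ_four, hcap 0, hcap 1, hcap 2, hcap 3, sum_finset_fin_four, sum_finset_fin_four, sum_finset_fin_four,
    sum_finset_fin_four, sum_finset_fin_four]
  simp +decide only [Fin.isValue, if_true, if_false, if_pos htop, card_empty,
    card_singleton, c01, c02, c03, c12, c13, c23, c012, c013, c023, c123, cu, κu, κ012, κ013, κ023, κ123, κ01, κ02, κ03, κ12, κ13, κ23, Nat.cast_zero, zero_mul, mul_zero, Nat.cast_one,
    Nat.cast_ofNat, Nat.factorial_zero, Nat.factorial_one, f2, f3, Nat.sub_self, Nat.add_one_sub_one, one_mul, mul_one]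
  ring

/-- **SDH♭ on four points, on the linear relaxation**: `Λ(𝒢, β) ≥ 0` for every union-closed `𝒢 ∋ univ` and every `0 ≤ β ≤ 1`
satisfying the pairwise-union inequalities `β_S + β_T ≤ 1 + β_{S∪T}` (the LOC′(3) mechanism, DELETION-PICTURE Prop. 3.2). [this work] -/
theorem lam_four_nonneg_of_pairUnion (𝒢 : Finset (Finset (Fin 4))) (hG : ∀ A ∈ 𝒢, ∀ A' ∈ 𝒢, A ∪ A' ∈ 𝒢) (htop : univ ∈ 𝒢)
    (β : Finset (Fin 4) → ℝ) (h0 : ∀ B, 0 ≤ β B) (h1 : ∀ B, β B ≤ 1) (hu : ∀ S T : Finset (Fin 4), β S + β T ≤ 1 + β (S ∪ T)) :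
    0 ≤ lam 𝒢 β := by
  rw [lam_four_eq 𝒢 htop β]
  have gle : ∀ S : Finset (Fin 4), (if S ∈ 𝒢 then (1:ℝ) else 0) ≤ 1 := fun S => by split_ifs <;> norm_num
  have guc : ∀ S T : Finset (Fin 4),
      (if S ∈ 𝒢 then (1:ℝ) else 0) + (if T ∈ 𝒢 then (1:ℝ) else 0) ≤ 1 + (if S ∪ T ∈ 𝒢 then (1:ℝ) else 0) := by
    intro S T
    by_cases hS : S ∈ 𝒢
    · by_cases hT : T ∈ 𝒢
      · rw [if_pos hS, if_pos hT, if_pos (hG S hS T hT)]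
      · rw [if_pos hS, if_neg hT]; split_ifs <;> norm_num
    · rw [if_neg hS]; split_ifs <;> norm_num
  have e01 : ({0} : Finset (Fin 4)) ∪ {1} = {0, 1} := by decide
  have u01 : β {0} + β {1} ≤ 1 + β {0, 1} := by have := hu {0} {1}; rwa [e01] at this
  have w01 : (if ({0} : Finset (Fin 4)) ∈ 𝒢 then (1:ℝ) else 0) + (if ({1} : Finset (Fin 4)) ∈ 𝒢 then (1:ℝ) else 0) ≤ 1 + (if ({0, 1} : Finset (Fin 4)) ∈ 𝒢 then (1:ℝ) else 0) := by
    have := guc {0} {1}; rwa [e01] at this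
  have e02 : ({0} : Finset (Fin 4)) ∪ {2} = {0, 2} := by decide
  have u02 : β {0} + β {2} ≤ 1 + β {0, 2} := by have := hu {0} {2}; rwa [e02] at this
  have w02 : (if ({0} : Finset (Fin 4)) ∈ 𝒢 then (1:ℝ) else 0) + (if ({2} : Finset (Fin 4)) ∈ 𝒢 then (1:ℝ) else 0) ≤ 1 + (if ({0, 2} : Finset (Fin 4)) ∈ 𝒢 then (1:ℝ) else 0) := by
    have := guc {0} {2}; rwa [e02] at this
  have e03 : ({0} : Finset (Fin 4)) ∪ {3} = {0, 3} := by decide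
  have u03 : β {0} + β {3} ≤ 1 + β {0, 3} := by have := hu {0} {3}; rwa [e03] at this
  have w03 : (if ({0} : Finset (Fin 4)) ∈ 𝒢 then (1:ℝ) else 0) + (if ({3} : Finset (Fin 4)) ∈ 𝒢 then (1:ℝ) else 0) ≤ 1 + (if ({0, 3} : Finset (Fin 4)) ∈ 𝒢 then (1:ℝ) else 0) := by
    have := guc {0} {3}; rwa [e03] at this
  have e12 : ({1} : Finset (Fin 4)) ∪ {2} = {1, 2} := by decide
  have u12 : β {1} + β {2} ≤ 1 + β {1, 2} := by have := hu {1} {2}; rwa [e12] at this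
  have w12 : (if ({1} : Finset (Fin 4)) ∈ 𝒢 then (1:ℝ) else 0) + (if ({2} : Finset (Fin 4)) ∈ 𝒢 then (1:ℝ) else 0) ≤ 1 + (if ({1, 2} : Finset (Fin 4)) ∈ 𝒢 then (1:ℝ) else 0) := by
    have := guc {1} {2}; rwa [e12] at this
  have e13 : ({1} : Finset (Fin 4)) ∪ {3} = {1, 3} := by decide
  have u13 : β {1} + β {3} ≤ 1 + β {1, 3} := by have := hu {1} {3}; rwa [e13] at this
  have w13 : (if ({1} : Finset (Fin 4)) ∈ 𝒢 then (1:ℝ) else 0) + (if ({3} : Finset (Fin 4)) ∈ 𝒢 then (1:ℝ) else 0) ≤ 1 + (if ({1, 3} : Finset (Fin 4)) ∈ 𝒢 then (1:ℝ) else 0) := by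
    have := guc {1} {3}; rwa [e13] at this
  have e23 : ({2} : Finset (Fin 4)) ∪ {3} = {2, 3} := by decide
  have u23 : β {2} + β {3} ≤ 1 + β {2, 3} := by have := hu {2} {3}; rwa [e23] at this
  have w23 : (if ({2} : Finset (Fin 4)) ∈ 𝒢 then (1:ℝ) else 0) + (if ({3} : Finset (Fin 4)) ∈ 𝒢 then (1:ℝ) else 0) ≤ 1 + (if ({2, 3} : Finset (Fin 4)) ∈ 𝒢 then (1:ℝ) else 0) := by
    have := guc {2} {3}; rwa [e23] at this
  have q01 : ((1 - (if ({0} : Finset (Fin 4)) ∈ 𝒢 then (1:ℝ) else 0)) + (1 - (if ({1} : Finset (Fin 4)) ∈ 𝒢 then (1:ℝ) else 0))) * (2 * min 0 (β {2, 3} - β {2} * β {3})) ≤ (1 - (if ({0, 1} : Finset (Fin 4)) ∈ 𝒢 then (1:ℝ) else 0)) * (2 * (β {2, 3} - β {2} * β {3})) :=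
    pair_charge (gle {0, 1}) w01
  have q02 : ((1 - (if ({0} : Finset (Fin 4)) ∈ 𝒢 then (1:ℝ) else 0)) + (1 - (if ({2} : Finset (Fin 4)) ∈ 𝒢 then (1:ℝ) else 0))) * (2 * min 0 (β {1, 3} - β {1} * β {3})) ≤ (1 - (if ({0, 2} : Finset (Fin 4)) ∈ 𝒢 then (1:ℝ) else 0)) * (2 * (β {1, 3} - β {1} * β {3})) :=
    pair_charge (gle {0, 2}) w02
  have q03 : ((1 - (if ({0} : Finset (Fin 4)) ∈ 𝒢 then (1:ℝ) else 0)) + (1 - (if ({3} : Finset (Fin 4)) ∈ 𝒢 then (1:ℝ) else 0))) * (2 * min 0 (β {1, 2} - β {1} * β {2})) ≤ (1 - (if ({0, 3} : Finset (Fin 4)) ∈ 𝒢 then (1:ℝ) else 0)) * (2 * (β {1, 2} - β {1} * β {2})) :=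
    pair_charge (gle {0, 3}) w03
  have q12 : ((1 - (if ({1} : Finset (Fin 4)) ∈ 𝒢 then (1:ℝ) else 0)) + (1 - (if ({2} : Finset (Fin 4)) ∈ 𝒢 then (1:ℝ) else 0))) * (2 * min 0 (β {0, 3} - β {0} * β {3})) ≤ (1 - (if ({1, 2} : Finset (Fin 4)) ∈ 𝒢 then (1:ℝ) else 0)) * (2 * (β {0, 3} - β {0} * β {3})) :=
    pair_charge (gle {1, 2}) w12
  have q13 : ((1 - (if ({1} : Finset (Fin 4)) ∈ 𝒢 then (1:ℝ) else 0)) + (1 - (if ({3} : Finset (Fin 4)) ∈ 𝒢 then (1:ℝ) else 0))) * (2 * min 0 (β {0, 2} - β {0} * β {2})) ≤ (1 - (if ({1, 3} : Finset (Fin 4)) ∈ 𝒢 then (1:ℝ) else 0)) * (2 * (β {0, 2} - β {0} * β {2})) :=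
    pair_charge (gle {1, 3}) w13
  have q23 : ((1 - (if ({2} : Finset (Fin 4)) ∈ 𝒢 then (1:ℝ) else 0)) + (1 - (if ({3} : Finset (Fin 4)) ∈ 𝒢 then (1:ℝ) else 0))) * (2 * min 0 (β {0, 1} - β {0} * β {1})) ≤ (1 - (if ({2, 3} : Finset (Fin 4)) ∈ 𝒢 then (1:ℝ) else 0)) * (2 * (β {0, 1} - β {0} * β {1})) :=
    pair_charge (gle {2, 3}) w23
  have x01 : β {0} * β {1} - 1 ≤ -(β {0, 1} - β {0} * β {1}) + 2 * min 0 (β {0, 1} - β {0} * β {1}) :=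
    absX_le (h0 {0}) (h1 {0}) (h0 {1}) (h1 {1}) (h1 {0, 1}) u01
  have x02 : β {0} * β {2} - 1 ≤ -(β {0, 2} - β {0} * β {2}) + 2 * min 0 (β {0, 2} - β {0} * β {2}) :=
    absX_le (h0 {0}) (h1 {0}) (h0 {2}) (h1 {2}) (h1 {0, 2}) u02
  have x03 : β {0} * β {3} - 1 ≤ -(β {0, 3} - β {0} * β {3}) + 2 * min 0 (β {0, 3} - β {0} * β {3}) :=
    absX_le (h0 {0}) (h1 {0}) (h0 {3}) (h1 {3}) (h1 {0, 3}) u03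
  have x12 : β {1} * β {2} - 1 ≤ -(β {1, 2} - β {1} * β {2}) + 2 * min 0 (β {1, 2} - β {1} * β {2}) :=
    absX_le (h0 {1}) (h1 {1}) (h0 {2}) (h1 {2}) (h1 {1, 2}) u12
  have x13 : β {1} * β {3} - 1 ≤ -(β {1, 3} - β {1} * β {3}) + 2 * min 0 (β {1, 3} - β {1} * β {3}) :=
    absX_le (h0 {1}) (h1 {1}) (h0 {3}) (h1 {3}) (h1 {1, 3}) u13
  have x23 : β {2} * β {3} - 1 ≤ -(β {2, 3} - β {2} * β {3}) + 2 * min 0 (β {2, 3} - β {2} * β {3}) :=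
    absX_le (h0 {2}) (h1 {2}) (h0 {3}) (h1 {3}) (h1 {2, 3}) u23
  have l0 : 0 ≤ 6 - 2 * (β {1} + β {2} + β {3}) - ((β {1, 2} - β {1} * β {2}) + (β {1, 3} - β {1} * β {3}) + (β {2, 3} - β {2} * β {3}))
      + 2 * (min 0 (β {1, 2} - β {1} * β {2}) + min 0 (β {1, 3} - β {1} * β {3}) + min 0 (β {2, 3} - β {2} * β {3})) :=
    link_nonneg (h1 {1}) (h1 {2}) (h1 {3}) x12 x13 x23
  have m0 : 0 ≤ (1 - (if ({0} : Finset (Fin 4)) ∈ 𝒢 then (1:ℝ) else 0)) * (6 - 2 * (β {1} + β {2} + β {3}) - ((β {1, 2} - β {1} * β {2}) + (β {1, 3} - β {1} * β {3}) + (β {2, 3} - β {2} * β {3}))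
      + 2 * (min 0 (β {1, 2} - β {1} * β {2}) + min 0 (β {1, 3} - β {1} * β {3}) + min 0 (β {2, 3} - β {2} * β {3}))) := mul_nonneg (by linarith [gle {0}]) l0
  have l1 : 0 ≤ 6 - 2 * (β {0} + β {2} + β {3}) - ((β {0, 2} - β {0} * β {2}) + (β {0, 3} - β {0} * β {3}) + (β {2, 3} - β {2} * β {3}))
      + 2 * (min 0 (β {0, 2} - β {0} * β {2}) + min 0 (β {0, 3} - β {0} * β {3}) + min 0 (β {2, 3} - β {2} * β {3})) :=
    link_nonneg (h1 {0}) (h1 {2}) (h1 {3}) x02 x03 x23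
  have m1 : 0 ≤ (1 - (if ({1} : Finset (Fin 4)) ∈ 𝒢 then (1:ℝ) else 0)) * (6 - 2 * (β {0} + β {2} + β {3}) - ((β {0, 2} - β {0} * β {2}) + (β {0, 3} - β {0} * β {3}) + (β {2, 3} - β {2} * β {3}))
      + 2 * (min 0 (β {0, 2} - β {0} * β {2}) + min 0 (β {0, 3} - β {0} * β {3}) + min 0 (β {2, 3} - β {2} * β {3}))) := mul_nonneg (by linarith [gle {1}]) l1
  have l2 : 0 ≤ 6 - 2 * (β {0} + β {1} + β {3}) - ((β {0, 1} - β {0} * β {1}) + (β {0, 3} - β {0} * β {3}) + (β {1, 3} - β {1} * β {3}))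
      + 2 * (min 0 (β {0, 1} - β {0} * β {1}) + min 0 (β {0, 3} - β {0} * β {3}) + min 0 (β {1, 3} - β {1} * β {3})) :=
    link_nonneg (h1 {0}) (h1 {1}) (h1 {3}) x01 x03 x13
  have m2 : 0 ≤ (1 - (if ({2} : Finset (Fin 4)) ∈ 𝒢 then (1:ℝ) else 0)) * (6 - 2 * (β {0} + β {1} + β {3}) - ((β {0, 1} - β {0} * β {1}) + (β {0, 3} - β {0} * β {3}) + (β {1, 3} - β {1} * β {3}))
      + 2 * (min 0 (β {0, 1} - β {0} * β {1}) + min 0 (β {0, 3} - β {0} * β {3}) + min 0 (β {1, 3} - β {1} * β {3}))) := mul_nonneg (by linarith [gle {2}]) l2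
  have l3 : 0 ≤ 6 - 2 * (β {0} + β {1} + β {2}) - ((β {0, 1} - β {0} * β {1}) + (β {0, 2} - β {0} * β {2}) + (β {1, 2} - β {1} * β {2}))
      + 2 * (min 0 (β {0, 1} - β {0} * β {1}) + min 0 (β {0, 2} - β {0} * β {2}) + min 0 (β {1, 2} - β {1} * β {2})) :=
    link_nonneg (h1 {0}) (h1 {1}) (h1 {2}) x01 x02 x12
  have m3 : 0 ≤ (1 - (if ({3} : Finset (Fin 4)) ∈ 𝒢 then (1:ℝ) else 0)) * (6 - 2 * (β {0} + β {1} + β {2}) - ((β {0, 1} - β {0} * β {1}) + (β {0, 2} - β {0} * β {2}) + (β {1, 2} - β {1} * β {2}))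
      + 2 * (min 0 (β {0, 1} - β {0} * β {1}) + min 0 (β {0, 2} - β {0} * β {2}) + min 0 (β {1, 2} - β {1} * β {2}))) := mul_nonneg (by linarith [gle {3}]) l3
  have r0 : 0 ≤ (1 - (if ({1, 2, 3} : Finset (Fin 4)) ∈ 𝒢 then (1:ℝ) else 0)) * (6 * β {0}) := mul_nonneg (by linarith [gle {1, 2, 3}]) (by linarith [h0 {0}])
  have r1 : 0 ≤ (1 - (if ({0, 2, 3} : Finset (Fin 4)) ∈ 𝒢 then (1:ℝ) else 0)) * (6 * β {1}) := mul_nonneg (by linarith [gle {0, 2, 3}]) (by linarith [h0 {1}])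
  have r2 : 0 ≤ (1 - (if ({0, 1, 3} : Finset (Fin 4)) ∈ 𝒢 then (1:ℝ) else 0)) * (6 * β {2}) := mul_nonneg (by linarith [gle {0, 1, 3}]) (by linarith [h0 {2}])
  have r3 : 0 ≤ (1 - (if ({0, 1, 2} : Finset (Fin 4)) ∈ 𝒢 then (1:ℝ) else 0)) * (6 * β {3}) := mul_nonneg (by linarith [gle {0, 1, 2}]) (by linarith [h0 {3}])
  linarith [q01, q02, q03, q12, q13, q23, m0, m1, m2, m3, r0, r1, r2, r3]

/-- Mixtures of union-closed indicator functions satisfy the pairwise-union inequalities `β_S + β_T ≤ 1 + β_{S∪T}`. [this work] -/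
theorem mixture_add_le_one_add_union {k : ℕ} {α : Type} [Fintype α] (w : α → ℝ) (𝒰 : α → Finset (Finset (Fin k)))
    (hw0 : ∀ x, 0 ≤ w x) (hw1 : ∑ x, w x = 1) (hUC : ∀ x, ∀ A ∈ 𝒰 x, ∀ A' ∈ 𝒰 x, A ∪ A' ∈ 𝒰 x) (S T : Finset (Fin k)) :
    (∑ x, w x * (if S ∈ 𝒰 x then (1 : ℝ) else 0)) + (∑ x, w x * (if T ∈ 𝒰 x then (1 : ℝ) else 0)) ≤
      1 + ∑ x, w x * (if S ∪ T ∈ 𝒰 x then (1 : ℝ) else 0) := by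
  have hpt : ∀ x, w x * (if S ∈ 𝒰 x then (1 : ℝ) else 0) + w x * (if T ∈ 𝒰 x then (1 : ℝ) else 0) ≤
      w x * 1 + w x * (if S ∪ T ∈ 𝒰 x then (1 : ℝ) else 0) := by
    intro x
    rw [← mul_add, ← mul_add]
    refine mul_le_mul_of_nonneg_left ?_ (hw0 x)
    by_cases hS : S ∈ 𝒰 x
    · by_cases hT : T ∈ 𝒰 x
      · rw [if_pos hS, if_pos hT, if_pos (hUC x S hS T hT)]
      · rw [if_pos hS, if_neg hT]; split_ifs <;> norm_num
    · rw [if_neg hS]; split_ifs <;> norm_num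
  calc (∑ x, w x * (if S ∈ 𝒰 x then (1 : ℝ) else 0)) + (∑ x, w x * (if T ∈ 𝒰 x then (1 : ℝ) else 0))
      = ∑ x, (w x * (if S ∈ 𝒰 x then (1 : ℝ) else 0) + w x * (if T ∈ 𝒰 x then (1 : ℝ) else 0)) := by rw [← sum_add_distrib]
    _ ≤ ∑ x, (w x * 1 + w x * (if S ∪ T ∈ 𝒰 x then (1 : ℝ) else 0)) := sum_le_sum fun x _ => hpt x
    _ = 1 + ∑ x, w x * (if S ∪ T ∈ 𝒰 x then (1 : ℝ) else 0) := by rw [sum_add_distrib, ← sum_mul, hw1, one_mul]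

/-- **SDH♭(4)** (`SDHFlatNonneg 4`): one union-closed family against one point of the union-closed hull, on four points. [this work] -/
theorem sdhFlatNonneg_four : SDHFlatNonneg 4 := by
  intro α _ w 𝒰 hw0 hw1 hUC _ 𝒢 hG htop
  exact lam_four_nonneg_of_pairUnion 𝒢 hG htop _ (fun B => mixture_nonneg w 𝒰 hw0 B) (fun B => mixture_le_one w 𝒰 hw0 hw1 B)
    (fun S T => mixture_add_le_one_add_union w 𝒰 hw0 hw1 hUC S T)

end SDHFlat

end Summit.CriticalPhenomena.PercolationContinuityZ3.Theorems
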